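import Summits.PneNP.PneNP.Theses.LyapunovRefutations

/-!
# Route LyapunovRefutations — `LayeredCertSound` (stmt-PneNP-10250)

SOUNDNESS of layered max-linear certificates (card P1; the Lyapunov ⇒ stable ⇒ UNSAT direction, matrix-free): a layered
certificate of `φ` exists only if `φ` is unsatisfiable.

Proof. Suppose `w` satisfies `φ` and let `p` be its path through the layers. Run the mass dynamics from `x⁰ = (0, 𝟙)`:
at layer `j` the mass `x.2 i` of every clause `i` containing the literal `(j, w j)` moves into `x.1`. Mass is conserved
(`x.1 + ∑ x.2 i = m`, `m = φ.length`) and `xʲ.2 i = 0` exactly when clause `i` was hit before layer `j`; since `w`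
satisfies `φ` and every variable is `< n = φ.numVars`, at layer `n` the state is `(m, 0)`. Condition (L2) gives a leaf
piece `q` with `q(xⁿ) ≥ m`; (PC+L1) pulls it back layer by layer to a root piece `q₀` with `q₀(x⁰) ≥ m`; but
`q₀(x⁰) = ∑ q₀.2 i < m` by (L3). Contradiction. [TsitsiklisBlondel1997; AhmadiEtAl2014]
-/

set_option linter.dupNamespace false -- `Summit.PneNP.PneNP.…`: summit = sub-problem name (D-0017 single-conjunct layout)

namespace Summit.PneNP.PneNP.Theorems

open Literature.Computability.Complexity

/-- **Support item `LayeredCertSound` of route LyapunovRefutations (stmt-PneNP-10250)**: a layered max-linear certificate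
(path condition PC+L1 for every word, leaf domination L2, root deficiency L3) exists only for unsatisfiable CNFs — run the
satisfying word's mass dynamics forward to `(m, 0)` and pull the dominating leaf piece back to the root.
[cite: TsitsiklisBlondel1997] [cite: AhmadiEtAl2014] -/
theorem lyapunovRefutations_layeredCertSound_proof :
    Summit.PneNP.PneNP.Theses.LyapunovRefutations.LayeredCertSound := by
  unfold Summit.PneNP.PneNP.Theses.LyapunovRefutations.LayeredCertSound
  rintro φ N P ⟨hPC, hL2, hL3⟩ ⟨w, hw⟩
  classical
  obtain ⟨p, hpN, hstep⟩ := hPC w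
  -- the mass dynamics of the satisfying word `w`
  let T : ℕ → ℚ × (Fin φ.length → ℚ) → ℚ × (Fin φ.length → ℚ) := fun j x =>
    (x.1 + ∑ i, (if ((j, w j) : ℕ × Bool) ∈ φ[i] then x.2 i else 0),
      fun i => if ((j, w j) : ℕ × Bool) ∈ φ[i] then 0 else x.2 i)
  let x : ℕ → ℚ × (Fin φ.length → ℚ) := fun j => Nat.rec ((0 : ℚ), fun _ => (1 : ℚ)) (fun k y => T k y) j
  have hx0 : x 0 = ((0 : ℚ), fun _ => (1 : ℚ)) := rfl
  have hx1 : ∀ j, (x (j + 1)).1 = (x j).1 + ∑ i, (if ((j, w j) : ℕ × Bool) ∈ φ[i] then (x j).2 i else 0) :=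
    fun j => rfl
  have hx2 : ∀ j i, (x (j + 1)).2 i = if ((j, w j) : ℕ × Bool) ∈ φ[i] then 0 else (x j).2 i :=
    fun j i => rfl
  -- nonnegativity
  have hnn : ∀ j, 0 ≤ (x j).1 ∧ ∀ i, 0 ≤ (x j).2 i := by
    intro j
    induction j with
    | zero => exact ⟨le_rfl, fun _ => zero_le_one⟩
    | succ j ih =>
      refine ⟨?_, fun i => ?_⟩
      · rw [hx1]
        refine add_nonneg ih.1 (Finset.sum_nonneg fun i _ => ?_)
        split_ifs
        · exact ih.2 i
        · exact le_rfl
      · rw [hx2]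
        split_ifs
        · exact le_rfl
        · exact ih.2 i
  -- closed form of the clause masses: `0` iff the clause was hit before layer `j`
  have hcl : ∀ j i, (x j).2 i = if ∃ j' < j, ((j', w j') : ℕ × Bool) ∈ φ[i] then 0 else 1 := by
    intro j
    induction j with
    | zero =>
      intro i
      have hno : ¬ ∃ j' < 0, ((j', w j') : ℕ × Bool) ∈ φ[i] := fun ⟨j', hj', _⟩ => (Nat.not_lt_zero j') hj'
      rw [if_neg hno, hx0]
    | succ j ih =>
      intro i
      rw [hx2]
      by_cases h : ((j, w j) : ℕ × Bool) ∈ φ[i]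
      · rw [if_pos h, if_pos ⟨j, Nat.lt_succ_self j, h⟩]
      · have hiff : (∃ j' < j + 1, ((j', w j') : ℕ × Bool) ∈ φ[i]) ↔ ∃ j' < j, ((j', w j') : ℕ × Bool) ∈ φ[i] := by
          constructor
          · rintro ⟨j', hj', hm⟩
            rcases Nat.lt_succ_iff_lt_or_eq.1 hj' with hlt | rfl
            · exact ⟨j', hlt, hm⟩
            · exact absurd hm h
          · rintro ⟨j', hj', hm⟩
            exact ⟨j', Nat.lt_succ_of_lt hj', hm⟩
        rw [if_neg h, ih i]
        exact if_congr hiff.symm rfl rfl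
  -- mass conservation
  have hmass : ∀ j, (x j).1 + ∑ i, (x j).2 i = (φ.length : ℚ) := by
    intro j
    induction j with
    | zero => simp [hx0]
    | succ j ih =>
      rw [hx1, ← ih, add_assoc]
      congr 1
      rw [← Finset.sum_add_distrib]
      refine Finset.sum_congr rfl fun i _ => ?_
      rw [hx2]
      split_ifs <;> simp
  -- every clause is hit before layer `n = φ.numVars` (because `w` satisfies `φ`)
  have hhit : ∀ i : Fin φ.length, ∃ j' < φ.numVars, ((j', w j') : ℕ × Bool) ∈ φ[i] := by
    intro i
    have hc : (φ[i] : Clause ℕ) ∈ φ := List.getElem_mem _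
    have hci : Clause.eval w φ[i] = true := (CNF.eval_eq_true_iff φ w).1 hw _ hc
    obtain ⟨l, hl, hlw⟩ := List.any_eq_true.1 hci
    have hval : w l.1 = l.2 := by simpa [Literal.eval] using hlw
    refine ⟨l.1, CNF.lt_numVars_of_mem_of_mem hc hl, ?_⟩
    rw [hval]
    exact hl
  have hxn2 : ∀ i, (x φ.numVars).2 i = 0 := fun i => by rw [hcl]; exact if_pos (hhit i)
  have hxn1 : (x φ.numVars).1 = (φ.length : ℚ) := by
    have := hmass φ.numVars
    simpa [hxn2] using this
  -- backward induction: a dominating piece at every layer along the path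
  have hback : ∀ d j, j + d = φ.numVars →
      ∃ q ∈ P j (p j), (φ.length : ℚ) ≤ q.1 * (x j).1 + ∑ i, q.2 i * (x j).2 i := by
    intro d
    induction d with
    | zero =>
      intro j hj
      rw [Nat.add_zero] at hj
      subst hj
      obtain ⟨q, hq, hle⟩ := hL2 (p φ.numVars) (hpN _ le_rfl) (x φ.numVars) (hnn _).1 (hnn _).2
      exact ⟨q, hq, hxn1 ▸ hle⟩
    | succ d ih =>
      intro j hj
      obtain ⟨q', hq', hle'⟩ := ih (j + 1) (by omega)
      obtain ⟨q, hq, hle⟩ := hstep j (by omega) (x j) (hnn j).1 (hnn j).2 q' hq'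
      have key : q'.1 * (x (j + 1)).1 + ∑ i, q'.2 i * (x (j + 1)).2 i
          = q'.1 * ((x j).1 + ∑ i, (if ((j, w j) : ℕ × Bool) ∈ φ[i] then (x j).2 i else 0))
            + ∑ i, q'.2 i * (if ((j, w j) : ℕ × Bool) ∈ φ[i] then 0 else (x j).2 i) := rfl
      exact ⟨q, hq, (hle'.trans_eq key).trans hle⟩
  obtain ⟨q, hq, hle⟩ := hback φ.numVars 0 (Nat.zero_add _)
  have hlt := hL3 (p 0) (hpN 0 (Nat.zero_le _)) q hq
  have h0 : q.1 * (x 0).1 + ∑ i, q.2 i * (x 0).2 i = ∑ i, q.2 i := by simp [hx0]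
  rw [h0] at hle
  exact absurd (hle.trans_lt hlt) (lt_irrefl _)

end Summit.PneNP.PneNP.Theorems
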